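import Mathlib.Data.Nat.Choose.Basic
import Mathlib.Data.Nat.Factorial.Basic
import Mathlib.Algebra.BigOperators.Intervals
import Mathlib.Algebra.Order.BigOperators.Group.Finset
import Mathlib.Tactic
import Summits.CriticalPhenomena.PercolationContinuityZ3.Theorems.PercNearOneGluingNoHeavyLowerTailCoreCauchy
import Summits.CriticalPhenomena.PercolationContinuityZ3.Theorems.PercNearOneGluingNoHeavyLowerTailCoreClaim
import Summits.CriticalPhenomena.PercolationContinuityZ3.Theorems.PercNearOneGluingNoHeavyLowerTailOmegaOne
import HarnessLib

/-!
# THEOREM DF1 at θ-level: LSM-Z-2D for every single-type de Finetti law, all real θ > 0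

Support file for the Sahi / Conjecture-P programme of route `PercNearOneGluingNoHeavy`
(`--supports stmt-CriticalPhenomena-4575`, prover prim-l12-p5 gen 29; proof notes
`prim-l12-p5/OMEGA-g25.md` §3.1–3.2, `prim-l12-p5/CORE-g26.md` §3.1).  No definitions, no named facts,
no sorries.

The two-block cycle partition function of the single-type de Finetti law `X(j,k) = θ(1-P^jQ^k)` is, in
odds `λ = p/P`, `μ = q/Q` and up to the factor `P^αQ^γ`,
`T_θ(α,γ) = ∑_{j ≤ α, l ≤ γ} C(α,j)C(γ,l) λ^j μ^l · θ^{(j+l)} · (j+l)^{(α+γ-j-l)}`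
(`θ^{(k)} = ∏_{i<k}(θ+i)`; `k^{(n-k)} = (n-1)!/(k-1)!` counts the list structures headed by the `k` hit
points).  THEOREM DF1 (LSM-Z-2D): `T(a+1,c)·T(a,c+1) ≤ T(a+1,c+1)·T(a,c)`.

Bernstein averaging (`CoreCauchy.cauchy₂`, `CoreClaim.term₁₁/term₁₀` at `s = 0`) reduces the
coefficient of `λ^{h₁}μ^{h₂}` to the fixed-hit-set inequality (Ω₁) = `OmegaOne.omega_one` — the
rising factorials `θ^{(i)}θ^{(h-i)}` ride along unchanged.

* `coeff_ineq` : the coefficientwise comparison;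
* `de_finetti_lsm` (**THEOREM DF1, θ-level, all real `θ > 0`, all odds `λ, μ ≥ 0`**), `de_finetti_lsm_origin`
  (the square at `(0,0)`).
-/

namespace Summit.CriticalPhenomena.PercolationContinuityZ3.Theorems

namespace DeFinettiLSM

open Finset

/-- **The coefficient inequality** at θ-level: the coefficient of `λ^{h₁}μ^{h₂}` in `T(a+1,c)T(a,c+1)`
is at most that in `T(a+1,c+1)T(a,c)` (`a + c ≥ 1`, `θ > 0`). -/
theorem coeff_ineq (a c h₁ h₂ : ℕ) (hn : 1 ≤ a + c) (hh₁' : h₁ ≤ 2 * a + 1)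
    (hh₂' : h₂ ≤ 2 * c + 1) (θ : ℝ) (hθ : 0 < θ) :
    ∑ i₁ ∈ range (h₁ + 1), ∑ i₂ ∈ range (h₂ + 1),
      (if (i₁ ≤ a + 1 ∧ h₁ - i₁ ≤ a) ∧ (i₂ ≤ c ∧ h₂ - i₂ ≤ c + 1) then
        ((a + 1).choose i₁ : ℝ) * (c.choose i₂ : ℝ) *
            ((∏ k ∈ range (i₁ + i₂), (θ + k)) * ((i₁ + i₂).ascFactorial (a + 1 + c - (i₁ + i₂)) : ℝ)) *
          ((a.choose (h₁ - i₁) : ℝ) * ((c + 1).choose (h₂ - i₂) : ℝ) *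
            ((∏ k ∈ range (h₁ - i₁ + (h₂ - i₂)), (θ + k)) *
              ((h₁ - i₁ + (h₂ - i₂)).ascFactorial (a + (c + 1) - (h₁ - i₁ + (h₂ - i₂))) : ℝ)))
        else 0) ≤
    ∑ i₁ ∈ range (h₁ + 1), ∑ i₂ ∈ range (h₂ + 1),
      (if (i₁ ≤ a + 1 ∧ h₁ - i₁ ≤ a) ∧ (i₂ ≤ c + 1 ∧ h₂ - i₂ ≤ c) then
        ((a + 1).choose i₁ : ℝ) * ((c + 1).choose i₂ : ℝ) *
            ((∏ k ∈ range (i₁ + i₂), (θ + k)) * ((i₁ + i₂).ascFactorial (a + 1 + (c + 1) - (i₁ + i₂)) : ℝ)) *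
          ((a.choose (h₁ - i₁) : ℝ) * (c.choose (h₂ - i₂) : ℝ) *
            ((∏ k ∈ range (h₁ - i₁ + (h₂ - i₂)), (θ + k)) *
              ((h₁ - i₁ + (h₂ - i₂)).ascFactorial (a + c - (h₁ - i₁ + (h₂ - i₂))) : ℝ)))
        else 0) := by
  -- the rising-factorial weight of a term
  have hR : ∀ m : ℕ, (0 : ℝ) ≤ ∏ k ∈ range m, (θ + k) := fun m =>
    prod_nonneg fun k _ => by positivity
  rcases Nat.eq_zero_or_pos h₂ with h20 | h2pos
  · -- no block-2 hits: termwise comparison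
    subst h20
    simp only [show (0 : ℕ) + 1 = 1 from rfl, sum_range_one]
    refine sum_le_sum fun i₁ hi₁ => ?_
    have hi₁' : i₁ ≤ h₁ := by have := mem_range.mp hi₁; omega
    split_ifs with g1 g2
    · have key := CoreCauchy.asc_step 0 (a + c) i₁ (h₁ - i₁) (by omega) (by omega)
      have hle : (0 + i₁).ascFactorial (a + c + 1 - i₁) * (0 + (h₁ - i₁)).ascFactorial (a + c + 1 - (h₁ - i₁)) ≤
          (0 + i₁).ascFactorial (a + c + 2 - i₁) * (0 + (h₁ - i₁)).ascFactorial (a + c - (h₁ - i₁)) := by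
        exact Nat.le_of_mul_le_mul_left (by rw [key]; exact Nat.mul_le_mul_right _ (by omega))
          (show 0 < 0 + (a + c) by omega)
      simp only [Nat.zero_add] at hle
      have hler : ((i₁.ascFactorial (a + c + 1 - i₁) : ℕ) : ℝ) *
          (((h₁ - i₁).ascFactorial (a + c + 1 - (h₁ - i₁)) : ℕ) : ℝ) ≤
          ((i₁.ascFactorial (a + c + 2 - i₁) : ℕ) : ℝ) *
          (((h₁ - i₁).ascFactorial (a + c - (h₁ - i₁)) : ℕ) : ℝ) := by exact_mod_cast hle
      simp only [add_zero, Nat.sub_zero, Nat.choose_zero_right, Nat.cast_one, mul_one]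
      rw [show a + 1 + c - i₁ = a + c + 1 - i₁ by omega,
        show a + (c + 1) - (h₁ - i₁) = a + c + 1 - (h₁ - i₁) by omega,
        show a + 1 + (c + 1) - i₁ = a + c + 2 - i₁ by omega]
      have hC : (0 : ℝ) ≤ ((a + 1).choose i₁ : ℝ) * (a.choose (h₁ - i₁) : ℝ) *
          ((∏ k ∈ range i₁, (θ + k)) * ∏ k ∈ range (h₁ - i₁), (θ + k)) :=
        mul_nonneg (by positivity) (mul_nonneg (hR _) (hR _))
      nlinarith [mul_le_mul_of_nonneg_left hler hC]
    · exact absurd ⟨g1.1, by omega, by omega⟩ g2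
    · exact mul_nonneg (mul_nonneg (by positivity) (mul_nonneg (hR _) (by positivity)))
        (mul_nonneg (by positivity) (mul_nonneg (hR _) (by positivity)))
    · exact le_rfl
  rcases Nat.eq_zero_or_pos h₁ with h10 | h1pos
  · -- no block-1 hits: reflect block 2, then termwise
    subst h10
    simp only [show (0 : ℕ) + 1 = 1 from rfl, sum_range_one]
    rw [← sum_range_reflect _ (h₂ + 1)]
    refine sum_le_sum fun j hj => ?_
    have hj' : j ≤ h₂ := by have := mem_range.mp hj; omega
    simp only [Nat.add_sub_cancel]
    rw [show h₂ - (h₂ - j) = j by omega]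
    split_ifs with g1 g2
    · have key := CoreCauchy.asc_step 0 (a + c) j (h₂ - j) (by omega) (by omega)
      have hle : (0 + j).ascFactorial (a + c + 1 - j) * (0 + (h₂ - j)).ascFactorial (a + c + 1 - (h₂ - j)) ≤
          (0 + j).ascFactorial (a + c + 2 - j) * (0 + (h₂ - j)).ascFactorial (a + c - (h₂ - j)) := by
        exact Nat.le_of_mul_le_mul_left (by rw [key]; exact Nat.mul_le_mul_right _ (by omega))
          (show 0 < 0 + (a + c) by omega)
      simp only [Nat.zero_add] at hle
      have hler : ((j.ascFactorial (a + c + 1 - j) : ℕ) : ℝ) *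
          (((h₂ - j).ascFactorial (a + c + 1 - (h₂ - j)) : ℕ) : ℝ) ≤
          ((j.ascFactorial (a + c + 2 - j) : ℕ) : ℝ) *
          (((h₂ - j).ascFactorial (a + c - (h₂ - j)) : ℕ) : ℝ) := by exact_mod_cast hle
      simp only [zero_add, Nat.sub_zero, Nat.choose_zero_right, Nat.cast_one, one_mul]
      rw [show a + 1 + c - (h₂ - j) = a + c + 1 - (h₂ - j) by omega,
        show a + (c + 1) - j = a + c + 1 - j by omega,
        show a + 1 + (c + 1) - j = a + c + 2 - j by omega]
      have hC : (0 : ℝ) ≤ ((c + 1).choose j : ℝ) * (c.choose (h₂ - j) : ℝ) *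
          ((∏ k ∈ range j, (θ + k)) * ∏ k ∈ range (h₂ - j), (θ + k)) :=
        mul_nonneg (by positivity) (mul_nonneg (hR _) (hR _))
      nlinarith [mul_le_mul_of_nonneg_left hler hC]
    · exact absurd ⟨⟨by omega, by omega⟩, by omega, by omega⟩ g2
    · exact mul_nonneg (mul_nonneg (by positivity) (mul_nonneg (hR _) (by positivity)))
        (mul_nonneg (by positivity) (mul_nonneg (hR _) (by positivity)))
    · exact le_rfl
  -- both blocks hit: Bernstein averaging constant `K₀` and (Ω₁)
  have hK : (0 : ℝ) < (((2 * a + 1).choose (a + 1) * (2 * c + 1).choose (c + 1) *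
      (h₁ + h₂ + 2 * 0 - 2).factorial : ℕ) : ℝ) := by
    exact_mod_cast Nat.mul_pos (Nat.mul_pos (Nat.choose_pos (by omega)) (Nat.choose_pos (by omega)))
      (Nat.factorial_pos _)
  refine le_of_mul_le_mul_left ?_ hK
  rw [mul_sum, mul_sum]
  simp_rw [mul_sum]
  -- split off the θ-weights termwise and apply the `s = 0` term identities of `CoreClaim`
  have split₁₀ : ∀ i₁ ∈ range (h₁ + 1), ∀ i₂ ∈ range (h₂ + 1),
      (((2 * a + 1).choose (a + 1) * (2 * c + 1).choose (c + 1) * (h₁ + h₂ + 2 * 0 - 2).factorial : ℕ) : ℝ) *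
        (if (i₁ ≤ a + 1 ∧ h₁ - i₁ ≤ a) ∧ (i₂ ≤ c ∧ h₂ - i₂ ≤ c + 1) then
          ((a + 1).choose i₁ : ℝ) * (c.choose i₂ : ℝ) *
              ((∏ k ∈ range (i₁ + i₂), (θ + k)) * ((i₁ + i₂).ascFactorial (a + 1 + c - (i₁ + i₂)) : ℝ)) *
            ((a.choose (h₁ - i₁) : ℝ) * ((c + 1).choose (h₂ - i₂) : ℝ) *
              ((∏ k ∈ range (h₁ - i₁ + (h₂ - i₂)), (θ + k)) *
                ((h₁ - i₁ + (h₂ - i₂)).ascFactorial (a + (c + 1) - (h₁ - i₁ + (h₂ - i₂))) : ℝ)))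
          else 0) =
      (((2 * a + 1).choose h₁ * (2 * c + 1).choose h₂ *
          ((0 + (a + c)).factorial * (0 + (a + c)).factorial) : ℕ) : ℝ) *
        ((h₁.choose i₁ : ℝ) * (if i₁ ≤ a + 1 then ((2 * a + 1 - h₁).choose (a + 1 - i₁) : ℝ) else 0) *
          ((h₂.choose i₂ : ℝ) * (if i₂ ≤ c then ((2 * c + 1 - h₂).choose (c - i₂) : ℝ) else 0)) *
          ((if 1 ≤ i₁ + i₂ + 0 then ((h₁ + h₂ + 2 * 0 - 2).choose (i₁ + i₂ + 0 - 1) : ℝ) else 0) *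
            ((∏ k ∈ range (i₁ + i₂), (θ + k)) * ∏ k ∈ range (h₁ + h₂ - (i₁ + i₂)), (θ + k)))) := by
    intro i₁ hi₁ i₂ hi₂
    have hi₁' : i₁ ≤ h₁ := by have := mem_range.mp hi₁; omega
    have hi₂' : i₂ ≤ h₂ := by have := mem_range.mp hi₂; omega
    have T := CoreClaim.term₁₀ a c 0 h₁ h₂ i₁ i₂ h1pos h2pos hh₁' hh₂' hi₁' hi₂'
    have hsum : h₁ - i₁ + (h₂ - i₂) = h₁ + h₂ - (i₁ + i₂) := by omega
    rw [hsum]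
    -- both sides are (old identity) × (θ-weight)
    have e1 : (((2 * a + 1).choose (a + 1) * (2 * c + 1).choose (c + 1) * (h₁ + h₂ + 2 * 0 - 2).factorial : ℕ) : ℝ) *
        (if (i₁ ≤ a + 1 ∧ h₁ - i₁ ≤ a) ∧ (i₂ ≤ c ∧ h₂ - i₂ ≤ c + 1) then
          ((a + 1).choose i₁ : ℝ) * (c.choose i₂ : ℝ) *
              ((∏ k ∈ range (i₁ + i₂), (θ + k)) * ((i₁ + i₂).ascFactorial (a + 1 + c - (i₁ + i₂)) : ℝ)) *
            ((a.choose (h₁ - i₁) : ℝ) * ((c + 1).choose (h₂ - i₂) : ℝ) *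
              ((∏ k ∈ range (h₁ + h₂ - (i₁ + i₂)), (θ + k)) *
                ((h₁ + h₂ - (i₁ + i₂)).ascFactorial (a + (c + 1) - (h₁ + h₂ - (i₁ + i₂))) : ℝ)))
          else 0) =
        ((((2 * a + 1).choose (a + 1) * (2 * c + 1).choose (c + 1) * (h₁ + h₂ + 2 * 0 - 2).factorial : ℕ) : ℝ) *
          (if (i₁ ≤ a + 1 ∧ h₁ - i₁ ≤ a) ∧ (i₂ ≤ c ∧ h₂ - i₂ ≤ c + 1) then
            ((a + 1).choose i₁ : ℝ) * (c.choose i₂ : ℝ) *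
                ((0 + (i₁ + i₂)).ascFactorial (a + 1 + c - (i₁ + i₂)) : ℝ) *
              ((a.choose (h₁ - i₁) : ℝ) * ((c + 1).choose (h₂ - i₂) : ℝ) *
                ((0 + (h₁ - i₁ + (h₂ - i₂))).ascFactorial (a + (c + 1) - (h₁ - i₁ + (h₂ - i₂))) : ℝ))
            else 0)) *
          ((∏ k ∈ range (i₁ + i₂), (θ + k)) * ∏ k ∈ range (h₁ + h₂ - (i₁ + i₂)), (θ + k)) := by
      simp only [Nat.zero_add]
      rw [hsum]
      split_ifs <;> ring
    rw [e1, T]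
    ring
  have split₁₁ : ∀ i₁ ∈ range (h₁ + 1), ∀ i₂ ∈ range (h₂ + 1),
      (((2 * a + 1).choose (a + 1) * (2 * c + 1).choose (c + 1) * (h₁ + h₂ + 2 * 0 - 2).factorial : ℕ) : ℝ) *
        (if (i₁ ≤ a + 1 ∧ h₁ - i₁ ≤ a) ∧ (i₂ ≤ c + 1 ∧ h₂ - i₂ ≤ c) then
          ((a + 1).choose i₁ : ℝ) * ((c + 1).choose i₂ : ℝ) *
              ((∏ k ∈ range (i₁ + i₂), (θ + k)) * ((i₁ + i₂).ascFactorial (a + 1 + (c + 1) - (i₁ + i₂)) : ℝ)) *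
            ((a.choose (h₁ - i₁) : ℝ) * (c.choose (h₂ - i₂) : ℝ) *
              ((∏ k ∈ range (h₁ - i₁ + (h₂ - i₂)), (θ + k)) *
                ((h₁ - i₁ + (h₂ - i₂)).ascFactorial (a + c - (h₁ - i₁ + (h₂ - i₂))) : ℝ)))
          else 0) =
      (((2 * a + 1).choose h₁ * (2 * c + 1).choose h₂ *
          ((0 + (a + c) + 1).factorial * (0 + (a + c) - 1).factorial) : ℕ) : ℝ) *
        ((h₁.choose i₁ : ℝ) * (if i₁ ≤ a + 1 then ((2 * a + 1 - h₁).choose (a + 1 - i₁) : ℝ) else 0) *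
          ((h₂.choose i₂ : ℝ) * (if i₂ ≤ c + 1 then ((2 * c + 1 - h₂).choose (c + 1 - i₂) : ℝ) else 0)) *
          ((if 1 ≤ i₁ + i₂ + 0 then ((h₁ + h₂ + 2 * 0 - 2).choose (i₁ + i₂ + 0 - 1) : ℝ) else 0) *
            ((∏ k ∈ range (i₁ + i₂), (θ + k)) * ∏ k ∈ range (h₁ + h₂ - (i₁ + i₂)), (θ + k)))) := by
    intro i₁ hi₁ i₂ hi₂
    have hi₁' : i₁ ≤ h₁ := by have := mem_range.mp hi₁; omega
    have hi₂' : i₂ ≤ h₂ := by have := mem_range.mp hi₂; omega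
    have T := CoreClaim.term₁₁ a c 0 h₁ h₂ i₁ i₂ (by omega) h1pos h2pos hh₁' hh₂' hi₁' hi₂'
    have hsum : h₁ - i₁ + (h₂ - i₂) = h₁ + h₂ - (i₁ + i₂) := by omega
    rw [hsum]
    have e1 : (((2 * a + 1).choose (a + 1) * (2 * c + 1).choose (c + 1) * (h₁ + h₂ + 2 * 0 - 2).factorial : ℕ) : ℝ) *
        (if (i₁ ≤ a + 1 ∧ h₁ - i₁ ≤ a) ∧ (i₂ ≤ c + 1 ∧ h₂ - i₂ ≤ c) then
          ((a + 1).choose i₁ : ℝ) * ((c + 1).choose i₂ : ℝ) *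
              ((∏ k ∈ range (i₁ + i₂), (θ + k)) * ((i₁ + i₂).ascFactorial (a + 1 + (c + 1) - (i₁ + i₂)) : ℝ)) *
            ((a.choose (h₁ - i₁) : ℝ) * (c.choose (h₂ - i₂) : ℝ) *
              ((∏ k ∈ range (h₁ + h₂ - (i₁ + i₂)), (θ + k)) *
                ((h₁ + h₂ - (i₁ + i₂)).ascFactorial (a + c - (h₁ + h₂ - (i₁ + i₂))) : ℝ)))
          else 0) =
        ((((2 * a + 1).choose (a + 1) * (2 * c + 1).choose (c + 1) * (h₁ + h₂ + 2 * 0 - 2).factorial : ℕ) : ℝ) *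
          (if (i₁ ≤ a + 1 ∧ h₁ - i₁ ≤ a) ∧ (i₂ ≤ c + 1 ∧ h₂ - i₂ ≤ c) then
            ((a + 1).choose i₁ : ℝ) * ((c + 1).choose i₂ : ℝ) *
                ((0 + (i₁ + i₂)).ascFactorial (a + 1 + (c + 1) - (i₁ + i₂)) : ℝ) *
              ((a.choose (h₁ - i₁) : ℝ) * (c.choose (h₂ - i₂) : ℝ) *
                ((0 + (h₁ - i₁ + (h₂ - i₂))).ascFactorial (a + c - (h₁ - i₁ + (h₂ - i₂))) : ℝ))
            else 0)) *
          ((∏ k ∈ range (i₁ + i₂), (θ + k)) * ∏ k ∈ range (h₁ + h₂ - (i₁ + i₂)), (θ + k)) := by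
      simp only [Nat.zero_add]
      rw [hsum]
      split_ifs <;> ring
    rw [e1, T]
    ring
  rw [sum_congr rfl fun i₁ hi₁ => sum_congr rfl fun i₂ hi₂ => split₁₀ i₁ hi₁ i₂ hi₂]
  rw [sum_congr rfl fun i₁ hi₁ => sum_congr rfl fun i₂ hi₂ => split₁₁ i₁ hi₁ i₂ hi₂]
  simp_rw [← mul_sum]
  -- (Ω₁) for the hit pattern (h₁, h₂)
  have hΩ := OmegaOne.omega_one a c h₁ (2 * a + 1 - h₁) h₂ (2 * c + 1 - h₂) (by omega) (by omega)
    (by omega) θ hθ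
  simp only [add_zero, mul_zero, zero_add] at hΩ ⊢
  have hf1 : (a + c).factorial = (a + c) * (a + c - 1).factorial := by
    have := Nat.factorial_succ (a + c - 1)
    rw [show a + c - 1 + 1 = a + c by omega] at this
    exact this
  have hf2 : (a + c + 1).factorial = (a + c + 1) * (a + c).factorial := Nat.factorial_succ _
  rw [hf2, hf1]
  push_cast
  have hP0 : (0 : ℝ) ≤ ((2 * a + 1).choose h₁ : ℝ) * ((2 * c + 1).choose h₂ : ℝ) *
      ((a + c - 1).factorial : ℝ) * ((a + c - 1).factorial : ℝ) * ((a : ℝ) + c) := by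
    positivity
  nlinarith [mul_le_mul_of_nonneg_left hΩ hP0]

/-- **THEOREM DF1 at θ-level (LSM-Z-2D for every single-type de Finetti law; OMEGA-g25 §2, CORE-g26 §0).**
For every real `θ > 0`, all odds `λ, μ ≥ 0` and `a + c ≥ 1`, the two-block cycle partition function
`T_θ(α,γ) = ∑_{j ≤ α, l ≤ γ} C(α,j)C(γ,l) λ^j μ^l · θ^{(j+l)} · (j+l)^{(α+γ-j-l)}` of the law
`X(j,k) = θ(1-P^jQ^k)` (`λ = p/P`, `μ = q/Q`; `θ^{(k)} = ∏_{i<k}(θ+i)`) is TP₂ on the unit square at `(a,c)`: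
`T(a+1,c)·T(a,c+1) ≤ T(a+1,c+1)·T(a,c)`.  Every coefficient of `λ^{h₁}μ^{h₂}` of the difference is a
positive multiple of the (Ω₁) difference of `OmegaOne.omega_one` (Bernstein averaging). -/
theorem de_finetti_lsm (a c : ℕ) (hn : 1 ≤ a + c) (θ : ℝ) (hθ : 0 < θ) (x y : ℝ) (hx : 0 ≤ x)
    (hy : 0 ≤ y) :
    (∑ j ∈ range (a + 1 + 1), ∑ l ∈ range (c + 1), ((a + 1).choose j : ℝ) * (c.choose l : ℝ) *
        ((∏ k ∈ range (j + l), (θ + k)) * ((j + l).ascFactorial (a + 1 + c - (j + l)) : ℝ)) *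
        (x ^ j * y ^ l)) *
      (∑ j ∈ range (a + 1), ∑ l ∈ range (c + 1 + 1), (a.choose j : ℝ) * ((c + 1).choose l : ℝ) *
        ((∏ k ∈ range (j + l), (θ + k)) * ((j + l).ascFactorial (a + (c + 1) - (j + l)) : ℝ)) *
        (x ^ j * y ^ l)) ≤
    (∑ j ∈ range (a + 1 + 1), ∑ l ∈ range (c + 1 + 1), ((a + 1).choose j : ℝ) * ((c + 1).choose l : ℝ) *
        ((∏ k ∈ range (j + l), (θ + k)) * ((j + l).ascFactorial (a + 1 + (c + 1) - (j + l)) : ℝ)) *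
        (x ^ j * y ^ l)) *
      (∑ j ∈ range (a + 1), ∑ l ∈ range (c + 1), (a.choose j : ℝ) * (c.choose l : ℝ) *
        ((∏ k ∈ range (j + l), (θ + k)) * ((j + l).ascFactorial (a + c - (j + l)) : ℝ)) *
        (x ^ j * y ^ l)) := by
  rw [CoreCauchy.cauchy₂ (fun j l => ((a + 1).choose j : ℝ) * (c.choose l : ℝ) *
      ((∏ k ∈ range (j + l), (θ + k)) * ((j + l).ascFactorial (a + 1 + c - (j + l)) : ℝ)))
    (fun j l => (a.choose j : ℝ) * ((c + 1).choose l : ℝ) *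
      ((∏ k ∈ range (j + l), (θ + k)) * ((j + l).ascFactorial (a + (c + 1) - (j + l)) : ℝ))),
    CoreCauchy.cauchy₂ (fun j l => ((a + 1).choose j : ℝ) * ((c + 1).choose l : ℝ) *
      ((∏ k ∈ range (j + l), (θ + k)) * ((j + l).ascFactorial (a + 1 + (c + 1) - (j + l)) : ℝ)))
    (fun j l => (a.choose j : ℝ) * (c.choose l : ℝ) *
      ((∏ k ∈ range (j + l), (θ + k)) * ((j + l).ascFactorial (a + c - (j + l)) : ℝ)))]
  rw [show c + (c + 1) + 1 = c + 1 + c + 1 by ring]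
  refine sum_le_sum fun h₁ hh₁ => sum_le_sum fun h₂ hh₂ => ?_
  have hh₁' : h₁ ≤ 2 * a + 1 := by have := mem_range.mp hh₁; omega
  have hh₂' : h₂ ≤ 2 * c + 1 := by have := mem_range.mp hh₂; omega
  exact mul_le_mul_of_nonneg_right (coeff_ineq a c h₁ h₂ hn hh₁' hh₂' θ hθ) (by positivity)

/-- The remaining unit square at `(a,c) = (0,0)` (excluded from `de_finetti_lsm` by `a + c ≥ 1`):
`θλ · θμ ≤ (θλ + θμ + θ(θ+1)λμ) · 1`. -/
theorem de_finetti_lsm_origin (θ : ℝ) (hθ : 0 < θ) (x y : ℝ) (hx : 0 ≤ x) (hy : 0 ≤ y) :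
    (∑ j ∈ range (0 + 1 + 1), ∑ l ∈ range (0 + 1), ((0 + 1).choose j : ℝ) * ((0 : ℕ).choose l : ℝ) *
        ((∏ k ∈ range (j + l), (θ + k)) * ((j + l).ascFactorial (0 + 1 + 0 - (j + l)) : ℝ)) *
        (x ^ j * y ^ l)) *
      (∑ j ∈ range (0 + 1), ∑ l ∈ range (0 + 1 + 1), ((0 : ℕ).choose j : ℝ) * ((0 + 1).choose l : ℝ) *
        ((∏ k ∈ range (j + l), (θ + k)) * ((j + l).ascFactorial (0 + (0 + 1) - (j + l)) : ℝ)) *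
        (x ^ j * y ^ l)) ≤
    (∑ j ∈ range (0 + 1 + 1), ∑ l ∈ range (0 + 1 + 1), ((0 + 1).choose j : ℝ) * ((0 + 1).choose l : ℝ) *
        ((∏ k ∈ range (j + l), (θ + k)) * ((j + l).ascFactorial (0 + 1 + (0 + 1) - (j + l)) : ℝ)) *
        (x ^ j * y ^ l)) *
      (∑ j ∈ range (0 + 1), ∑ l ∈ range (0 + 1), ((0 : ℕ).choose j : ℝ) * ((0 : ℕ).choose l : ℝ) *
        ((∏ k ∈ range (j + l), (θ + k)) * ((j + l).ascFactorial (0 + 0 - (j + l)) : ℝ)) *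
        (x ^ j * y ^ l)) := by
  simp [sum_range_succ, prod_range_succ, Nat.ascFactorial]
  nlinarith [mul_nonneg hx hy, mul_nonneg (mul_nonneg hx hy) hθ.le, mul_nonneg (mul_nonneg hx hy) (mul_nonneg hθ.le hθ.le)]

/-- From Bernstein weights to odds: `∑ f(j,l) p^j(1-p)^{α-j} q^l(1-q)^{γ-l} = (1-p)^α(1-q)^γ ∑ f(j,l) λ^jμ^l`
with `λ = p/(1-p)`, `μ = q/(1-q)` (`p, q < 1`). -/
theorem bernstein_to_odds (α γ : ℕ) (f : ℕ → ℕ → ℝ) (p q : ℝ) (hp1 : p < 1) (hq1 : q < 1) :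
    ∑ j ∈ range (α + 1), ∑ l ∈ range (γ + 1), f j l * (p ^ j * (1 - p) ^ (α - j) * (q ^ l * (1 - q) ^ (γ - l))) =
      (1 - p) ^ α * (1 - q) ^ γ *
        ∑ j ∈ range (α + 1), ∑ l ∈ range (γ + 1), f j l * ((p / (1 - p)) ^ j * (q / (1 - q)) ^ l) := by
  have hP : (1 - p) ≠ 0 := by linarith
  have hQ : (1 - q) ≠ 0 := by linarith
  rw [mul_sum]
  refine sum_congr rfl fun j hj => ?_
  rw [mul_sum]
  refine sum_congr rfl fun l hl => ?_
  have hj' : j ≤ α := by have := mem_range.mp hj; omega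
  have hl' : l ≤ γ := by have := mem_range.mp hl; omega
  have e1 : (1 - p) ^ α = (1 - p) ^ j * (1 - p) ^ (α - j) := by
    rw [← pow_add, Nat.add_sub_cancel' hj']
  have e2 : (1 - q) ^ γ = (1 - q) ^ l * (1 - q) ^ (γ - l) := by
    rw [← pow_add, Nat.add_sub_cancel' hl']
  rw [e1, e2, div_pow, div_pow]
  field_simp

/-- **THEOREM DF1 in probability form.**  For every real `θ > 0`, hit probabilities `p, q ∈ [0,1)` and
`a + c ≥ 1`, the two-block cycle partition function
`Z(α,γ) = ∑_{j,l} C(α,j)p^j(1-p)^{α-j} C(γ,l)q^l(1-q)^{γ-l} · θ^{(j+l)}(j+l)^{(α+γ-j-l)} = (α+γ-1)!·E[θ^{(K)}/(K-1)!]`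
(`K ~ Bin(α,p) ∗ Bin(γ,q)` the number of hit points) of the single-type de Finetti law `X(j,k) = θ(1-P^jQ^k)`
satisfies LSM-Z-2D: `Z(a+1,c)·Z(a,c+1) ≤ Z(a+1,c+1)·Z(a,c)`. -/
theorem de_finetti_lsm_prob (a c : ℕ) (hn : 1 ≤ a + c) (θ : ℝ) (hθ : 0 < θ) (p q : ℝ) (hp0 : 0 ≤ p)
    (hp1 : p < 1) (hq0 : 0 ≤ q) (hq1 : q < 1) :
    (∑ j ∈ range (a + 1 + 1), ∑ l ∈ range (c + 1), ((a + 1).choose j : ℝ) * (c.choose l : ℝ) *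
        ((∏ k ∈ range (j + l), (θ + k)) * ((j + l).ascFactorial (a + 1 + c - (j + l)) : ℝ)) *
        (p ^ j * (1 - p) ^ (a + 1 - j) * (q ^ l * (1 - q) ^ (c - l)))) *
      (∑ j ∈ range (a + 1), ∑ l ∈ range (c + 1 + 1), (a.choose j : ℝ) * ((c + 1).choose l : ℝ) *
        ((∏ k ∈ range (j + l), (θ + k)) * ((j + l).ascFactorial (a + (c + 1) - (j + l)) : ℝ)) *
        (p ^ j * (1 - p) ^ (a - j) * (q ^ l * (1 - q) ^ (c + 1 - l)))) ≤
    (∑ j ∈ range (a + 1 + 1), ∑ l ∈ range (c + 1 + 1), ((a + 1).choose j : ℝ) * ((c + 1).choose l : ℝ) *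
        ((∏ k ∈ range (j + l), (θ + k)) * ((j + l).ascFactorial (a + 1 + (c + 1) - (j + l)) : ℝ)) *
        (p ^ j * (1 - p) ^ (a + 1 - j) * (q ^ l * (1 - q) ^ (c + 1 - l)))) *
      (∑ j ∈ range (a + 1), ∑ l ∈ range (c + 1), (a.choose j : ℝ) * (c.choose l : ℝ) *
        ((∏ k ∈ range (j + l), (θ + k)) * ((j + l).ascFactorial (a + c - (j + l)) : ℝ)) *
        (p ^ j * (1 - p) ^ (a - j) * (q ^ l * (1 - q) ^ (c - l)))) := by
  rw [bernstein_to_odds _ _ _ p q hp1 hq1, bernstein_to_odds _ _ _ p q hp1 hq1,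
    bernstein_to_odds _ _ _ p q hp1 hq1, bernstein_to_odds _ _ _ p q hp1 hq1]
  have hT := de_finetti_lsm a c hn θ hθ (p / (1 - p)) (q / (1 - q))
    (div_nonneg hp0 (by linarith)) (div_nonneg hq0 (by linarith))
  have hP : 0 ≤ (1 - p) := by linarith
  have hQ : 0 ≤ (1 - q) := by linarith
  have hW : (0 : ℝ) ≤ (1 - p) ^ (a + 1) * (1 - q) ^ c * ((1 - p) ^ a * (1 - q) ^ (c + 1)) := by positivity
  have key := mul_le_mul_of_nonneg_left hT hW
  have e : (1 - p) ^ (a + 1) * (1 - q) ^ c * ((1 - p) ^ a * (1 - q) ^ (c + 1)) =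
      (1 - p) ^ (a + 1) * (1 - q) ^ (c + 1) * ((1 - p) ^ a * (1 - q) ^ c) := by ring
  calc _ = (1 - p) ^ (a + 1) * (1 - q) ^ c * ((1 - p) ^ a * (1 - q) ^ (c + 1)) *
        ((∑ j ∈ range (a + 1 + 1), ∑ l ∈ range (c + 1), ((a + 1).choose j : ℝ) * (c.choose l : ℝ) *
          ((∏ k ∈ range (j + l), (θ + k)) * ((j + l).ascFactorial (a + 1 + c - (j + l)) : ℝ)) *
          ((p / (1 - p)) ^ j * (q / (1 - q)) ^ l)) *
        (∑ j ∈ range (a + 1), ∑ l ∈ range (c + 1 + 1), (a.choose j : ℝ) * ((c + 1).choose l : ℝ) *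
          ((∏ k ∈ range (j + l), (θ + k)) * ((j + l).ascFactorial (a + (c + 1) - (j + l)) : ℝ)) *
          ((p / (1 - p)) ^ j * (q / (1 - q)) ^ l))) := by ring
    _ ≤ (1 - p) ^ (a + 1) * (1 - q) ^ c * ((1 - p) ^ a * (1 - q) ^ (c + 1)) *
        ((∑ j ∈ range (a + 1 + 1), ∑ l ∈ range (c + 1 + 1), ((a + 1).choose j : ℝ) * ((c + 1).choose l : ℝ) *
          ((∏ k ∈ range (j + l), (θ + k)) * ((j + l).ascFactorial (a + 1 + (c + 1) - (j + l)) : ℝ)) *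
          ((p / (1 - p)) ^ j * (q / (1 - q)) ^ l)) *
        (∑ j ∈ range (a + 1), ∑ l ∈ range (c + 1), (a.choose j : ℝ) * (c.choose l : ℝ) *
          ((∏ k ∈ range (j + l), (θ + k)) * ((j + l).ascFactorial (a + c - (j + l)) : ℝ)) *
          ((p / (1 - p)) ^ j * (q / (1 - q)) ^ l))) := key
    _ = _ := by rw [e]; ring

end DeFinettiLSM

end Summit.CriticalPhenomena.PercolationContinuityZ3.Theorems
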